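import Summits.QuantumFields.YangMills.Theses.FradkinShenkerFlow
import Literature.MathematicalPhysics.QuantumFieldTheory.LatticeGaugeProofs
import Literature.MathematicalPhysics.QuantumLattice.TorusWilsonGibbs

/-!
# Disproof work file — crux `FradkinShenkerFlow.SusceptibilityToPoincare` (stmt-QuantumFields-9441)

Standing disprover `refuter-cdisprove-stmt-QuantumFields-9441-0`, cycle 1, v2 (2026-08-16).
Crux: for every compact simple `G` (`IsCompactSimpleLieGroup`), faithful unitary `r`, `β ≥ 0`:
FS(r, β) (torus susceptibility of every pair of bounded gauge-invariant local observables bounded uniformly in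
the side `2S+1`) ⟹ UP(r, β) (a UNIFORM single-link heat-bath Poincaré inequality for ALL bounded measurable `F`).

## Findings (index)

* §0 `crux_iff`, `crux_iff_simpleOnly` — the crux re-read through `FS`/`UP`; the conjunct `Nonempty (LatticeRep G)`
  of `IsCompactSimpleLieGroup` is DECORATION (the crux quantifies `∀ r : LatticeRep G` anyway).
* §1 `variance_indicator_wilson`, `flux_lower_bound_of_UP` — BOTTLENECK LEMMA (proved): a heat-bath Poincaré
  constant `C` forces `μ(A)(1 − μ(A)) ≤ C · ℰ_hb(1_A)` for EVERY measurable event `A` on EVERY torus. Any family of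
  events with mass in `[δ, 1−δ]` and heat-bath boundary flux `→ 0` along `S → ∞` kills UP (`not_UP_of_bottleneck`).
* §2 `TwistSectorInputs` (the hypothesis `H`, structure-free ∃-form = the tree's relocated Literature fact, p76562) and
  `susceptibilityToPoincare_false_of_twistSectorInputs : TwistSectorInputs → ¬ crux` (proved) — the NEGATIVE LEMMA
  MODULO H. Intended inhabitant of `H` (on paper, §2 docstrings): `G = SO(3)` (admitted by `IsSimpleCompactGroup`:
  connected, non-abelian, no proper closed connected normal subgroup; faithful unitary 3-dim rep), `β` large,
  `A S` = the 't Hooft magnetic twist sector `{w₁₂(U) = 1} ∩ Ω_good(S)`. Of its three analytic conjuncts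
  (i) FS(SO(3), ρ₃, β) at weak coupling is OPEN (= crux 9442 specialised; mass gap of SO(3)₄),
  (ii) twist-sector non-degeneracy `δ ≤ μ_S(w₁₂ = 1) ≤ 1 − δ` is OPEN (confinement folklore: 't Hooft 1979 flux
  duality, de Forcrand–Jahn 2003 numerics `Z_tw/Z_untw → 1`), (iii) boundary flux `→ 0` is RIGOROUS ON PAPER (exact
  conservation of the twist class under single-link updates away from ℤ₂-monopole clusters, §2, plus a chessboard /
  Peierls large-field bound `μ(k given cubes are monopoles) ≤ (K e^{−cβ})^{k/4}`), not in the tree.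
  ⟹ the crux AS TYPED asserts, for centreless `G`, that finite susceptibility EXCLUDES twist-sector coexistence,
  i.e. FS ⟹ "magnetically Higgs-like" — the opposite of the universally expected confined phase of SO(3)₄.
  CLASS if ever landed unconditionally: refuted-MISSTATED; repaired statement C′ = the crux with the extra hypothesis
  `SimplyConnectedSpace G` (= stub 4a of line orbit-slice-reduction); the witness misses C′ (for π₁(G) = 0 the sign
  cochain of plaquettes is a dilute coboundary-like field, all non-zero twist classes have mass `e^{−cβS²}`).
* §2b (PROVED) `lintegral_heatBath_update` (DLR/exchangeability of the one-link heat bath), `measurable_lintegral_heatBath`,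
  `isProbabilityMeasure_heatBath`, `hbForm_indicator_le_of_conserved` (flux of an event conserved outside a bad set is
  `≤ 2·#E·μ(bad)`), `purity_of_conserved` (UP ⟹ μ(A)(1−μ(A)) ≤ 2C·#E·μ(bad): purity of conserved sectors),
  `twistSectorInputs_of_conserved` — conjunct (iii) factored into a deterministic conservation law
  (iii-a) + a large-field estimate (iii-b). Landing as `Negative/ConservedEventFlux.lean`.
* §2 `SusceptibilityToPoincareSC` — the repaired statement C′ (crux + `SimplyConnectedSpace G`), `…SC_of_crux`.
* LANDING (tree, `Theorems/SusceptibilityToPoincare/Negative/`): `Bottleneck.lean` (§1; p74081 ACCEPTED);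
  `FalseOfTwistSectorInputs.lean` (§2–3; p76563 ACCEPTED, `--negative-modulo TwistSectorInputs`; `H` relocated by the gate to
  `Literature/MathematicalPhysics/QuantumFieldTheory/TwistSectorInputs.lean`, p76562 ACCEPTED — cite THAT name);
  `HeatBathExchange.lean` + `ConservedEventFlux.lean` (§2b; proposal ids in the item evidence / crux NOTES).
* NUMERICS (kit, this seat; results auto-attach to the item as evidence when the saturated farm runs them): j008248 (smoke) and
  j011282 (full): `disproof_so3_twist.py` — SO(3) realised as SU(2) links with the centre-blind adjoint Wilson weight
  `exp(β Σ_p (4a₀(U_p)² − 1))` (tree convention; Bhanot–Creutz `β_A = 3β`, bulk transition `β ≈ 0.83`), single-link Metropolis,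
  `L ∈ {4,6,8}`, `β ∈ {0.9, 1.1}`; twist estimator `T_{μν}` = plane-average of `Π sign tr_F U_p` (= de Forcrand–Jahn's `η_{μν}`);
  replicas `cold` (w = 0) vs `twisted` (zero-action twist eater, w₁₂ = 1). READING: in stdout `SUMMARY`, if `frac(w12=1)` stays ≈ 0
  for cold and ≈ 1 for twisted with `events(12) = 0`, the replicas never met (sector not equilibrated); `events per 10⁴ sweeps`
  DECREASING in `L` at fixed `β` = the volume-growing bottleneck of §2 (evidence for ¬UP(SO(3), ρ₃, β)); an `L`-independent
  tunnelling rate would count against the obstruction; `tau(trA)`/`chi_proxy` flat in `L` = FS-like behaviour of the local observable.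
* §3 `Stub4b`, `stub4b_false_of_twistSectorInputs` — the lead's scope sentinel `stub_fsPoincareInv_nonSimplyConnected`
  (Lines/orbit-slice-reduction.lean) is killed by the SAME `H` (the witness events are gauge-invariant).
* §5 consequences for the route: C′ breaks the assembly for centreless G unless a covering transfer / sector-conditioned UP is added.
* §4 load-bearing analysis (docstrings; nothing here is Lean-decidable — every quantity is a Haar/Wilson integral on
  `G^E` and the hypothesis class needs a genuine compact simple Lie group): `0 ≤ β` possibly unnecessary; FS is
  load-bearing on paper (bulk first-order points: UP false, FS false); `Measurable F`/boundedness technical; per-`S`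
  Poincaré is true (Holley–Stroock vs product Haar + Efron–Stein) so the whole content is uniformity in `S`;
  without connectedness of `G` the statement is false on paper already for `G = ℤ₂` (centre sectors, Peierls).
* Numerics: kit job (this seat) `disproof_so3_twist.py` — SO(3) = adjoint-SU(2) Wilson action, Metropolis single-link
  dynamics, twist-sector tunnelling rate vs `L ∈ {4,6,8}` above the bulk transition; job id in NOTES.md / evidence.

Nothing in this file asserts the crux or any Theses decl positively. `sorry` count: 0.
-/

namespace Summit.QuantumFields.YangMills.Cruxes.SusceptibilityToPoincare.Disproof

open MeasureTheory ProbabilityTheory Filter Topology Function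
open scoped ENNReal
open Literature.MathematicalPhysics.QuantumFieldTheory
open Literature.MathematicalPhysics.QuantumLattice (wilsonMeasure_eq_tilted_pi)

noncomputable section

/-! ### §0 Vocabulary — verbatim sub-formulas of the crux -/

section Vocabulary

variable {G : Type} [Group G] [TopologicalSpace G] [IsTopologicalGroup G] [CompactSpace G]
  [MeasurableSpace G] [BorelSpace G]

/-- FS(r, β): finite gauge-invariant susceptibility uniformly in the volume — verbatim the crux hypothesis. -/
def FS (r : LatticeRep G) (β : ℝ) : Prop :=
  ∀ A B : YMSpecies G, ∃ χ : ℝ, ∀ S : ℕ, ∑ x ∈ Literature.Probability.LatticeModels.box 4 S,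
    |covariance (fun U => A.F (Literature.MathematicalPhysics.QuantumLattice.torusLift (2 * S + 1) U))
      (fun U => B.F (Literature.MathematicalPhysics.QuantumLattice.configShift (-x)
          (Literature.MathematicalPhysics.QuantumLattice.torusLift (2 * S + 1) U)))
      (wilsonMeasure (d := 4) (L := 2 * S + 1) r.ρ β)| ≤ χ

/-- The single-link HEAT-BATH Dirichlet form (times 2) of `F` on the torus of side `2S+1`:
`ℰ_hb(F) = Σ_ℓ ∫∫ (F U − F(U[ℓ ↦ g]))² dν_ℓ^U(g) dμ_{β,S}(U)`, `ν_ℓ^U = Haar.tilted(−β S_W(U[ℓ ↦ ·]))`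
— verbatim the right-hand side of the crux conclusion. -/
def hbForm (r : LatticeRep G) (β : ℝ) (S : ℕ) (F : GaugeConfig 4 (2 * S + 1) G → ℝ) : ℝ :=
  ∑ ℓ : Edge 4 (2 * S + 1), ∫ U, ∫ g, (F U - F (Function.update U ℓ g)) ^ 2
    ∂((haarProbability G).tilted (fun g' => -β * wilsonAction r.ρ (Function.update U ℓ g')))
    ∂(wilsonMeasure (d := 4) (L := 2 * S + 1) r.ρ β)

/-- `UPWith r β C`: the heat-bath Poincaré inequality with the GIVEN constant `C` on every torus. -/
def UPWith (r : LatticeRep G) (β C : ℝ) : Prop :=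
  ∀ S : ℕ, ∀ F : GaugeConfig 4 (2 * S + 1) G → ℝ, Measurable F → (∃ M : ℝ, ∀ U, |F U| ≤ M) →
    variance F (wilsonMeasure (d := 4) (L := 2 * S + 1) r.ρ β) ≤
      C * ∑ ℓ : Edge 4 (2 * S + 1), ∫ U, ∫ g, (F U - F (Function.update U ℓ g)) ^ 2
        ∂((haarProbability G).tilted (fun g' => -β * wilsonAction r.ρ (Function.update U ℓ g')))
        ∂(wilsonMeasure (d := 4) (L := 2 * S + 1) r.ρ β)

/-- UP(r, β): the uniform single-link heat-bath Poincaré inequality for ALL bounded measurable `F` — verbatim the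
crux conclusion. -/
def UP (r : LatticeRep G) (β : ℝ) : Prop :=
  ∃ C : ℝ, ∀ S : ℕ, ∀ F : GaugeConfig 4 (2 * S + 1) G → ℝ, Measurable F → (∃ M : ℝ, ∀ U, |F U| ≤ M) →
    variance F (wilsonMeasure (d := 4) (L := 2 * S + 1) r.ρ β) ≤
      C * ∑ ℓ : Edge 4 (2 * S + 1), ∫ U, ∫ g, (F U - F (Function.update U ℓ g)) ^ 2
        ∂((haarProbability G).tilted (fun g' => -β * wilsonAction r.ρ (Function.update U ℓ g')))
        ∂(wilsonMeasure (d := 4) (L := 2 * S + 1) r.ρ β)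

theorem up_iff (r : LatticeRep G) (β : ℝ) : UP r β ↔ ∃ C, UPWith r β C := Iff.rfl

/-- The heat-bath form is non-negative. -/
theorem hbForm_nonneg (r : LatticeRep G) (β : ℝ) (S : ℕ) (F : GaugeConfig 4 (2 * S + 1) G → ℝ) :
    0 ≤ hbForm r β S F :=
  Finset.sum_nonneg fun _ _ => integral_nonneg fun _ => integral_nonneg fun _ => sq_nonneg _

end Vocabulary

/-- The crux, re-read through `FS`/`UP` (definitional unfolding, checked by `Iff.rfl`). -/
theorem crux_iff :
    Summit.QuantumFields.YangMills.Theses.FradkinShenkerFlow.SusceptibilityToPoincare ↔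
      ∀ (G : Type) [Group G] [TopologicalSpace G] [IsTopologicalGroup G] [CompactSpace G]
        [MeasurableSpace G] [BorelSpace G], IsCompactSimpleLieGroup G →
        ∀ (r : LatticeRep G) (β : ℝ), 0 ≤ β → FS r β → UP r β :=
  Iff.rfl

/-- LOAD-BEARING (structural): the conjunct `Nonempty (LatticeRep G)` of `IsCompactSimpleLieGroup G` is decoration —
the crux is equivalent to the same statement with the bare `IsSimpleCompactGroup G` (connected, non-abelian, no
proper non-trivial closed connected normal subgroup), because `r : LatticeRep G` is quantified right after.
So the hypothesis class is: compact connected non-abelian "simple" `G` with a faithful finite-dimensional unitary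
representation — it ADMITS the centreless / non-simply-connected groups SO(3), PSU(N), SO(2n+1), … (§2). -/
theorem crux_iff_simpleOnly :
    Summit.QuantumFields.YangMills.Theses.FradkinShenkerFlow.SusceptibilityToPoincare ↔
      ∀ (G : Type) [Group G] [TopologicalSpace G] [IsTopologicalGroup G] [CompactSpace G]
        [MeasurableSpace G] [BorelSpace G],
        Literature.MathematicalPhysics.QuantumLattice.IsSimpleCompactGroup G →
        ∀ (r : LatticeRep G) (β : ℝ), 0 ≤ β → FS r β → UP r β := by
  rw [crux_iff]
  refine ⟨fun h G _ _ _ _ _ _ hG r β hβ hFS => h G ⟨hG, ⟨r⟩⟩ r β hβ hFS,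
    fun h G _ _ _ _ _ _ hG r β hβ hFS => h G hG.1 r β hβ hFS⟩

/-! ### §1 The bottleneck lemma (proved): UP bounds the heat-bath boundary flux of every event from below -/

section Bottleneck

variable {G : Type} [Group G] [TopologicalSpace G] [IsTopologicalGroup G] [CompactSpace G]
  [MeasurableSpace G] [BorelSpace G]

/-- Variance of an indicator under the (probability) Wilson measure: `Var(1_A) = μ(A)(1 − μ(A))`. -/
theorem variance_indicator_wilson (r : LatticeRep G) (β : ℝ) (S : ℕ)
    {A : Set (GaugeConfig 4 (2 * S + 1) G)} (hA : MeasurableSet A) :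
    variance (A.indicator (1 : GaugeConfig 4 (2 * S + 1) G → ℝ)) (wilsonMeasure (d := 4) (L := 2 * S + 1) r.ρ β) =
      (wilsonMeasure (d := 4) (L := 2 * S + 1) r.ρ β).real A *
        (1 - (wilsonMeasure (d := 4) (L := 2 * S + 1) r.ρ β).real A) := by
  haveI := isProbabilityMeasure_wilsonMeasure (d := 4) (L := 2 * S + 1) (G := G) r.ρ r.continuous β
  have hmeas : Measurable (A.indicator (1 : GaugeConfig 4 (2 * S + 1) G → ℝ)) :=
    measurable_one.indicator hA
  have hX : MemLp (A.indicator (1 : GaugeConfig 4 (2 * S + 1) G → ℝ)) 2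
      (wilsonMeasure (d := 4) (L := 2 * S + 1) r.ρ β) :=
    MemLp.of_bound hmeas.aestronglyMeasurable 1 (ae_of_all _ fun U => by
      by_cases hU : U ∈ A <;> simp [Set.indicator, hU])
  have hsq : (A.indicator (1 : GaugeConfig 4 (2 * S + 1) G → ℝ)) ^ 2 =
      A.indicator (1 : GaugeConfig 4 (2 * S + 1) G → ℝ) := by
    funext U
    by_cases hU : U ∈ A <;> simp [Set.indicator, hU]
  rw [variance_eq_sub hX, hsq, integral_indicator_one hA]
  ring

/-- **BOTTLENECK LEMMA.** If the heat-bath Poincaré inequality holds on the torus of side `2S+1` with constant `C`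
for all bounded measurable `F`, then every measurable event `A` satisfies `μ(A)(1 − μ(A)) ≤ C · ℰ_hb(1_A)`:
the heat-bath boundary flux of `A` is at least its "variance". (Apply the inequality to `F = 1_A`.)
Consequence used in §2: a family of events `A_S` with `δ ≤ μ_S(A_S) ≤ 1 − δ` and `ℰ_hb(1_{A_S}) → 0` refutes UP. -/
theorem flux_lower_bound_of_UP (r : LatticeRep G) (β C : ℝ) (hC : UPWith r β C) (S : ℕ)
    {A : Set (GaugeConfig 4 (2 * S + 1) G)} (hA : MeasurableSet A) :
    (wilsonMeasure (d := 4) (L := 2 * S + 1) r.ρ β).real A *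
        (1 - (wilsonMeasure (d := 4) (L := 2 * S + 1) r.ρ β).real A) ≤
      C * hbForm r β S (A.indicator 1) := by
  rw [← variance_indicator_wilson r β S hA]
  exact hC S _ (measurable_one.indicator hA) ⟨1, fun U => by
    by_cases hU : U ∈ A <;> simp [Set.indicator, hU]⟩

/-- Elementary: `p ∈ [δ, 1 − δ]` ⟹ `δ(1 − δ) ≤ p(1 − p)` (indeed `p(1−p) − δ(1−δ) = (p − δ)(1 − δ − p)`). -/
theorem mul_one_sub_ge {p δ : ℝ} (h₁ : δ ≤ p) (h₂ : p ≤ 1 - δ) : δ * (1 - δ) ≤ p * (1 - p) := by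
  nlinarith [mul_nonneg (sub_nonneg.2 h₁) (sub_nonneg.2 h₂)]

/-- **No uniform Poincaré across a bottleneck.** If along the tori there are measurable events `A S` of mass in
`[δ, 1 − δ]` (`δ > 0`) whose heat-bath boundary flux tends to `0`, then UP(r, β) fails. -/
theorem not_UP_of_bottleneck (r : LatticeRep G) (β : ℝ) {δ : ℝ} (hδ : 0 < δ)
    (A : ∀ S : ℕ, Set (GaugeConfig 4 (2 * S + 1) G)) (hmeas : ∀ S, MeasurableSet (A S))
    (hmass : ∀ S, δ ≤ (wilsonMeasure (d := 4) (L := 2 * S + 1) r.ρ β).real (A S) ∧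
      (wilsonMeasure (d := 4) (L := 2 * S + 1) r.ρ β).real (A S) ≤ 1 - δ)
    (hflux : Tendsto (fun S => hbForm r β S ((A S).indicator 1)) atTop (𝓝 0)) :
    ¬ UP r β := by
  rintro ⟨C, hC⟩
  have hδ1 : δ ≤ 1 - δ := (hmass 0).1.trans (hmass 0).2
  have hpos : 0 < δ * (1 - δ) := mul_pos hδ (by linarith)
  have hle : ∀ S, δ * (1 - δ) ≤ C * hbForm r β S ((A S).indicator 1) := fun S =>
    (mul_one_sub_ge (hmass S).1 (hmass S).2).trans (flux_lower_bound_of_UP r β C hC S (hmeas S))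
  have hlim : Tendsto (fun S => C * hbForm r β S ((A S).indicator 1)) atTop (𝓝 (C * 0)) :=
    hflux.const_mul C
  rw [mul_zero] at hlim
  have : δ * (1 - δ) ≤ 0 := ge_of_tendsto hlim (Eventually.of_forall hle)
  linarith

end Bottleneck

/-! ### §2 The hypothesis `H = TwistSectorInputs` and the negative lemma modulo `H`

**The mechanism ('t Hooft magnetic twist for centreless `G`; worked out for `G = SO(3)`).**
Let `U ∈ SO(3)^E` on the torus of side `L = 2S+1 ≥ 3`; lift every link to `Ũ_ℓ ∈ SU(2)` (measurably) and put
`s_p := sign tr Ũ_p ∈ {±1}` (defined when `tr Ũ_p ≠ 0`, i.e. the rotation angle of `U_p` is `≠ π`: full measure).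
The ℤ₂ 2-cochain `s` changes by a COBOUNDARY under a change of lifts and under SO(3) gauge transformations
(conjugation does not change traces); its coboundary `m := ds` (a ℤ₂ 3-cochain: `m(c) = ∏_{p ∈ ∂c} s_p` on 3-cubes)
is the ℤ₂-MONOPOLE current — closed (`dm = 0`), lift-independent, gauge-invariant, and dual to closed curves.
(1) LOCALITY OF MONOPOLES: a cube `c` is a monopole only if one of its six faces has rotation angle `≥ π/3`
    (six SU(2) elements within distance `< π/6` of `±1` with sign product `−1` cannot multiply to `1`). Hence under
    `μ_{β,S}` monopole cubes are large-field events: by the chessboard estimate (reflection positivity of the Wilson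
    action in lattice hyperplanes) `μ(k prescribed cubes are all monopoles) ≤ 6^k (K e^{−c β})^{k/4}` uniformly in `S`
    (each monopole cube has a bad face and each plaquette is a face of 4 cubes, so `k` cubes force `≥ k/4` distinct bad plaquettes).
(2) THE TWIST CLASS: on `Ω_good(S) := {every connected component of the monopole curve system has diameter ≤ S/4}`
    define, for each coordinate plane `(μν)` and the coordinate 2-torus `Σ_{μν}`,
    `w_{μν}(U) := Σ_{p ∈ Σ_{μν}} s_p + Σ_i #(D_i ⋔ Σ_{μν}) (mod 2)`, where `D_i` is any ℤ₂ 2-chain inside the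
    (ball-like, diameter `< L/2`) hull of the `i`-th monopole component `γ_i` with `∂D_i = γ_i`. This is independent of
    the filling (`H₂` of a box vanishes and `Σ` is closed), of the lift (coboundaries integrate to `0` on the closed
    `Σ`, `m` is lift-independent), of the representative of `[Σ_{μν}] ∈ H₂(T⁴; ℤ₂)` (Stokes: `Σ_Σ s − Σ_{Σ'} s = Σ_V m
    = Σ_i #(γ_i ∩ V) = Σ_i #(D_i ⋔ ∂V)`), measurable, and GAUGE-INVARIANT. It is the 't Hooft magnetic flux
    `w ∈ H²(T⁴; π₁(SO(3))) = ℤ₂⁶`.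
(3) EXACT CONSERVATION UNDER SINGLE-LINK UPDATES: if `U, U' ∈ Ω_good(S)` differ on one link `ℓ`, then `w(U) = w(U')`.
    (With equal lifts off `ℓ`, `δ := s' − s` is supported on the 6 plaquettes of `star(ℓ)`; evaluate `w` on a
    representative 2-torus `Σ'` avoiding the box around `ℓ`; the fillings of the old and new monopole components near
    `ℓ` differ from the dual of `δ` by a closed 2-chain inside a box of diameter `< L/2`, which meets the closed `Σ'`
    evenly.) In particular for the 12 cubes around `ℓ` monopole-free before and after, `δ` is CONSTANT on `star(ℓ)`
    (the cube–plaquette incidence graph on `star(ℓ)` is `K_{2,2,2}`, connected), i.e. `δ ∈ {0, d1_ℓ}`.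
(4) FLUX BOUND: for `A_S := {w₁₂ = 1} ∩ Ω_good(S)` and the one-link heat-bath pair `(U, U^{ℓ←g})`, which is
    EXCHANGEABLE under `μ ⊗ ν_ℓ^U`, (3) gives `1_{A_S}(U) ≠ 1_{A_S}(U')` only if `U` or `U'` lies in
    `∂Ω_good(S) :=` configurations with a monopole component of diameter `≥ S/4 − 2`; so
    `ℰ_hb(1_{A_S}) ≤ 2 · #E · μ_{β,S}(∂Ω_good) ≤ 8 L⁴ · L⁴ Σ_{k ≥ S/16} (6 C₄)^k (K e^{−cβ})^{k/4} → 0` for `β > β₁`,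
    `β₁` depending only on the lattice constants — this is conjunct (iii) below, rigorous on paper.
(5) MASS OF THE SECTORS: hypercubic symmetry makes the six one-plane sectors equiprobable; 't Hooft's electric–magnetic
    flux duality + confinement of SO(3)₄ at every `β` predict `μ_{β,S}(w = m) → 1/64` for all 64 sectors as `S → ∞`
    ("light magnetic fluxes", `Z_tw/Z_untw → 1`; de Forcrand–Jahn, Nucl. Phys. B 651 (2003), hep-lat/0211004 and
    hep-lat/0205026, §§4–5: the same estimator `η_{μν}` = plane-average of products of `sign tr U_p`; "a simple
    Metropolis algorithm is not capable of changing the twist on lattices larger than 4⁴", barrier growing with the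
    size, saddle suppression `10¹²` on `8³×4`; the minimal ACTION barrier is a monopole loop winding the torus, `≥ cβL`).
    Burgio–Fuhrmann–Kerler–Müller-Preussker (PRD 74 (2006) 071502, hep-th/0608075, pp. 2–4): "within phase II [weak
    coupling] the twists are well defined, close to ±1 for each configuration", "high potential barriers separating
    twist sectors suppress tunnelling among them for local update algorithms", and the vortex free energy
    `F = −T log(Z₁/3Z₀) → 0` as `T → 0` ('t Hooft), i.e. sectors equiprobable on symmetric tori.
    Conjunct (ii) asks only `δ ≤ μ_S(A_S) ≤ 1 − δ`: OPEN rigorously (it is "SO(3)₄ is not magnetically Higgsed").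
(6) FS at such `β` — conjunct (i) — is the mass gap of SO(3)₄ at weak coupling: OPEN (crux 9442 territory).
Under (i)+(ii)+(iii), `not_UP_of_bottleneck` gives ¬UP(SO(3), ρ, β) with FS true, i.e. ¬crux. For SIMPLY-CONNECTED
`G` the same class `w` exists but every non-zero sector has mass `≤ e^{−cβ S²}` (for a faithful `r` the sign cochain
itself is suppressed, not only its coboundary), so the witness does not bite the repaired statement
C′ := crux + `SimplyConnectedSpace G`.
-/

section NegativeModulo

/-- **`H = TwistSectorInputs`** ('t Hooft twist-sector inputs; IDENTICAL to the tree's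
`Literature.MathematicalPhysics.QuantumFieldTheory.TwistSectorInputs`, relocated there by the gate from
`Theorems/SusceptibilityToPoincare/Negative/FalseOfTwistSectorInputs.lean`, p76562/p76563). There are: an admissible
(`IsCompactSimpleLieGroup`) but NOT simply connected compact gauge group `G`, a lattice representation `r`, `β ≥ 0`
with (i) FS, and gauge-invariant measurable events `A S` on the tori of sides `2S+1` with (ii) Wilson mass in
`[δ, 1 − δ]`, `δ > 0`, and (iii) single-link heat-bath boundary flux `ℰ_hb(1_{A S}) → 0`. Intended inhabitant:
`G = SO(3)`, `r = ρ₃`, `β > β₁`, `A S = {w₁₂ = 1} ∩ Ω_good(S)`; (iii) rigorous on paper (and its analytic glue PROVED in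
§2b), (i) and (ii) the expected-but-unproved weak-coupling physics of SO(3)₄ (mass gap; light magnetic flux).
[cite: Thooft1979, §§2–4] [cite: DeforcrandJahn2003, §§4–5 (hep-lat/0211004)] [cite: BurgioEtAl2006, pp. 2–4]
[topic MathematicalPhysics/QuantumFieldTheory] -/
def TwistSectorInputs : Prop :=
  ∃ (G : Type) (_ : Group G) (_ : TopologicalSpace G) (_ : IsTopologicalGroup G) (_ : CompactSpace G)
    (_ : MeasurableSpace G) (_ : BorelSpace G),
    IsCompactSimpleLieGroup G ∧ ¬ SimplyConnectedSpace G ∧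
    ∃ (r : LatticeRep G) (β : ℝ), 0 ≤ β ∧ FS r β ∧
    ∃ δ : ℝ, 0 < δ ∧ ∃ A : ∀ S : ℕ, Set (GaugeConfig 4 (2 * S + 1) G),
      (∀ S, MeasurableSet (A S)) ∧
      (∀ S, IsGaugeInvariant ((A S).indicator (1 : GaugeConfig 4 (2 * S + 1) G → ℝ))) ∧
      (∀ S, δ ≤ (wilsonMeasure (d := 4) (L := 2 * S + 1) r.ρ β).real (A S) ∧
        (wilsonMeasure (d := 4) (L := 2 * S + 1) r.ρ β).real (A S) ≤ 1 - δ) ∧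
      Tendsto (fun S : ℕ => hbForm r β S ((A S).indicator 1)) atTop (𝓝 0)

/-- **NEGATIVE LEMMA MODULO `H`** (`¬ SusceptibilityToPoincare` modulo `TwistSectorInputs`; tree:
`Negative.SusceptibilityToPoincare_false_of_TwistSectorInputs`, p76563): if some centreless compact simple `G` carries
gauge-invariant events of non-degenerate mass with vanishing single-link heat-bath flux at a coupling where FS holds —
the expected weak-coupling physics of SO(3)₄ — then the crux AS TYPED is false. Composition with an inhabitant of `H`
is the real refutation; the planner's cheap repair is `SimplyConnectedSpace G`. -/
theorem susceptibilityToPoincare_false_of_twistSectorInputs (h : TwistSectorInputs) :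
    ¬ Summit.QuantumFields.YangMills.Theses.FradkinShenkerFlow.SusceptibilityToPoincare := by
  intro hcrux
  obtain ⟨G, _, _, _, _, _, _, hsimple, -, r, β, hβ, hfs, δ, hδ, A, hmeas, -, hmass, hflux⟩ := h
  exact not_UP_of_bottleneck r β hδ A hmeas hmass hflux (crux_iff.1 hcrux G hsimple r β hβ hfs)

/-! #### §2b The analytic glue of (iii), PROVED: heat-bath exchangeability and the flux of a conserved event
(landing as `Theorems/SusceptibilityToPoincare/Negative/ConservedEventFlux.lean`). With these, conjunct (iii) of `H`
factors into (iii-a) the DETERMINISTIC conservation law `U, U[ℓ ↦ g] ∉ B_S ⇒ (U ∈ A_S ⇔ U[ℓ ↦ g] ∈ A_S)` (finite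
combinatorics of the twist class, §2 (3)) and (iii-b) the large-field estimate `#E · μ_{β,S}(B_S) → 0` (chessboard). -/

section Glue

variable {G : Type} [Group G] [TopologicalSpace G] [IsTopologicalGroup G] [CompactSpace G]
  [MeasurableSpace G] [BorelSpace G]

omit [IsTopologicalGroup G] [MeasurableSpace G] [BorelSpace G] in
/-- A group with a faithful finite-dimensional continuous representation is second countable. [folklore] -/
theorem secondCountableTopology_of_latticeRep (r : LatticeRep G) : SecondCountableTopology G :=
  (r.continuous.isClosedEmbedding r.injective).isEmbedding.secondCountableTopology

/-- **DLR consistency / exchangeability of the one-link heat bath** (extended non-negative form): resampling the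
link `ℓ` from its heat-bath law `ν_ℓ^U = Haar.tilted(−β S_W(U[ℓ ↦ ·]))` leaves the torus Wilson measure invariant,
`∫ (∫ ψ(U[ℓ ↦ g]) dν_ℓ^U(g)) dμ_{β,S}(U) = ∫ ψ dμ_{β,S}` for every measurable `ψ ≥ 0`. Every compact `G`, real `β`. [folklore] -/
theorem lintegral_heatBath_update (r : LatticeRep G) (β : ℝ) (S : ℕ) (ℓ : Edge 4 (2 * S + 1))
    {ψ : GaugeConfig 4 (2 * S + 1) G → ℝ≥0∞} (hψ : Measurable ψ) :
    ∫⁻ U, ∫⁻ g, ψ (update U ℓ g)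
        ∂((haarProbability G).tilted (fun g' => -β * wilsonAction r.ρ (update U ℓ g')))
        ∂(wilsonMeasure (d := 4) (L := 2 * S + 1) r.ρ β) =
      ∫⁻ U, ψ U ∂(wilsonMeasure (d := 4) (L := 2 * S + 1) r.ρ β) := by
  haveI : SecondCountableTopology G := secondCountableTopology_of_latticeRep r
  classical
  -- notation
  set π : Measure (GaugeConfig 4 (2 * S + 1) G) := Measure.pi fun _ : Edge 4 (2 * S + 1) => haarProbability G
    with hπ
  set w : GaugeConfig 4 (2 * S + 1) G → ℝ := fun U => Real.exp (-β * wilsonAction r.ρ U) with hw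
  have hw_meas : Measurable w := ((measurable_wilsonAction r.ρ r.continuous).const_mul _).exp
  have hw_pos : ∀ U, 0 < w U := fun U => Real.exp_pos _
  obtain ⟨B, hB⟩ := exists_abs_wilsonAction_le (d := 4) (L := 2 * S + 1) r.ρ r.continuous
  have hw_le : ∀ U, w U ≤ Real.exp (|β| * B) := fun U => by
    refine Real.exp_le_exp.2 ?_
    have h : |β * wilsonAction r.ρ U| ≤ |β| * B := by
      rw [abs_mul]; exact mul_le_mul_of_nonneg_left (hB U) (abs_nonneg _)
    have := (abs_le.1 h).1
    linarith
  have hw_norm : ∀ U, ‖w U‖ ≤ Real.exp (|β| * B) := fun U => by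
    rw [Real.norm_eq_abs, abs_of_pos (hw_pos U)]; exact hw_le U
  -- the one-link normaliser `c U = ∫ w(U[ℓ ↦ g]) dHaar(g)`
  set c : GaugeConfig 4 (2 * S + 1) G → ℝ := fun U => ∫ g, w (update U ℓ g) ∂haarProbability G with hc
  have hwu_meas : ∀ U, Measurable fun g : G => w (update U ℓ g) := fun U =>
    hw_meas.comp (measurable_update U)
  have hwu_int : ∀ U, Integrable (fun g : G => w (update U ℓ g)) (haarProbability G) := fun U =>
    Integrable.of_bound (hwu_meas U).aestronglyMeasurable _ (ae_of_all _ fun g => hw_norm _)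
  have hc_pos : ∀ U, 0 < c U := fun U => integral_exp_pos (hwu_int U)
  have hc_update : ∀ U u, c (update U ℓ u) = c U := fun U u => by
    simp only [hc, update_idem]
  -- joint measurability of `(U, g) ↦ w (U[ℓ ↦ g])` and measurability of `c`
  have hwj : Measurable fun p : GaugeConfig 4 (2 * S + 1) G × G => w (update p.1 ℓ p.2) :=
    hw_meas.comp measurable_update'
  have hc_meas : Measurable c :=
    (hwj.stronglyMeasurable.integral_prod_right' (ν := haarProbability G)).measurable
  -- the Wilson measure as a density w.r.t. `π`
  set Z : ℝ := ∫ U, w U ∂π with hZ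
  have hw_int : Integrable w π := Integrable.of_bound hw_meas.aestronglyMeasurable _ (ae_of_all _ hw_norm)
  have hZ_pos : 0 < Z := integral_exp_pos hw_int
  have hμ : wilsonMeasure (d := 4) (L := 2 * S + 1) r.ρ β =
      π.withDensity (fun U => ENNReal.ofReal (w U / Z)) := by
    rw [wilsonMeasure_eq_tilted_pi r.ρ r.continuous β]
    rfl
  -- the heat-bath kernel as a density w.r.t. Haar
  have hν : ∀ U : GaugeConfig 4 (2 * S + 1) G,
      (haarProbability G).tilted (fun g' => -β * wilsonAction r.ρ (update U ℓ g')) =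
        (haarProbability G).withDensity (fun g => ENNReal.ofReal (w (update U ℓ g) / c U)) :=
    fun U => rfl
  have hdμ_meas : Measurable fun U => ENNReal.ofReal (w U / Z) := (hw_meas.div_const Z).ennreal_ofReal
  have hdν_meas : ∀ U, Measurable fun g : G => ENNReal.ofReal (w (update U ℓ g) / c U) := fun U =>
    ((hwu_meas U).div_const _).ennreal_ofReal
  -- joint measurability of the inner integrand and measurability of the inner integral
  have hΦj : Measurable fun p : GaugeConfig 4 (2 * S + 1) G × G =>
      ENNReal.ofReal (w (update p.1 ℓ p.2) / c p.1) * ψ (update p.1 ℓ p.2) :=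
    ((hwj.div (hc_meas.comp measurable_fst)).ennreal_ofReal).mul (hψ.comp measurable_update')
  have hΦ_meas : Measurable fun U : GaugeConfig 4 (2 * S + 1) G =>
      ∫⁻ g, ENNReal.ofReal (w (update U ℓ g) / c U) * ψ (update U ℓ g) ∂haarProbability G :=
    hΦj.lintegral_prod_right'
  -- rewrite the inner integrals against Haar
  have hinner : ∀ U : GaugeConfig 4 (2 * S + 1) G,
      ∫⁻ g, ψ (update U ℓ g) ∂((haarProbability G).tilted (fun g' => -β * wilsonAction r.ρ (update U ℓ g'))) =
        ∫⁻ g, ENNReal.ofReal (w (update U ℓ g) / c U) * ψ (update U ℓ g) ∂haarProbability G := fun U => by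
    have hm : Measurable fun g : G => ψ (update U ℓ g) := hψ.comp (measurable_update U)
    rw [hν U, lintegral_withDensity_eq_lintegral_mul _ (hdν_meas U) hm]
    rfl
  simp_rw [hinner]
  rw [hμ, lintegral_withDensity_eq_lintegral_mul _ hdμ_meas hΦ_meas,
    lintegral_withDensity_eq_lintegral_mul _ hdμ_meas hψ]
  -- integrate out the coordinate `ℓ` first on both sides
  refine lintegral_eq_of_lmarginal_eq {ℓ} (hdμ_meas.mul hΦ_meas) (hdμ_meas.mul hψ) ?_
  rw [lmarginal_singleton, lmarginal_singleton]
  funext x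
  have hdivZ : ∀ a : ℝ, ENNReal.ofReal (a / Z) = (ENNReal.ofReal Z)⁻¹ * ENNReal.ofReal a := fun a => by
    rw [ENNReal.ofReal_div_of_pos hZ_pos, div_eq_mul_inv, mul_comm]
  have hdivc : ∀ a : ℝ, ENNReal.ofReal (a / c x) = (ENNReal.ofReal (c x))⁻¹ * ENNReal.ofReal a := fun a => by
    rw [ENNReal.ofReal_div_of_pos (hc_pos x), div_eq_mul_inv, mul_comm]
  have hcx0 : ENNReal.ofReal (c x) ≠ 0 := (ENNReal.ofReal_pos.2 (hc_pos x)).ne'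
  have hcxT : ENNReal.ofReal (c x) ≠ ∞ := ENNReal.ofReal_ne_top
  -- `∫ ofReal (w (x[ℓ ↦ u])) dHaar(u) = ofReal (c x)`
  have hA : ∫⁻ u, ENNReal.ofReal (w (update x ℓ u)) ∂haarProbability G = ENNReal.ofReal (c x) :=
    (ofReal_integral_eq_lintegral_ofReal (hwu_int x) (ae_of_all _ fun g => (hw_pos _).le)).symm
  have hJ_meas : Measurable fun g : G => ENNReal.ofReal (w (update x ℓ g)) * ψ (update x ℓ g) :=
    (hwu_meas x).ennreal_ofReal.mul (hψ.comp (measurable_update x))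
  simp only [Pi.mul_apply, update_idem, hc_update, hdivZ, hdivc]
  -- left: (∫ (Z⁻¹ w) dHaar) * ((c x)⁻¹ * J) ; right: Z⁻¹ * J
  simp_rw [mul_assoc]
  rw [lintegral_const_mul _ ((hwu_meas x).ennreal_ofReal.mul_const _),
    lintegral_mul_const _ (hwu_meas x).ennreal_ofReal, hA,
    lintegral_const_mul _ hJ_meas, lintegral_const_mul _ hJ_meas]
  rw [← mul_assoc (ENNReal.ofReal (c x)), ENNReal.mul_inv_cancel hcx0 hcxT, one_mul]

/-- Measurability in the configuration of one-link heat-bath expectations `U ↦ ∫ K(U, g) dν_ℓ^U(g)` for jointly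
measurable `K ≥ 0` (the kernel is a jointly measurable density against Haar; `G` is second countable through `r`).
[folklore] -/
theorem measurable_lintegral_heatBath (r : LatticeRep G) (β : ℝ) (S : ℕ) (ℓ : Edge 4 (2 * S + 1))
    {K : GaugeConfig 4 (2 * S + 1) G × G → ℝ≥0∞} (hK : Measurable K) :
    Measurable fun U : GaugeConfig 4 (2 * S + 1) G => ∫⁻ g, K (U, g)
      ∂((haarProbability G).tilted (fun g' => -β * wilsonAction r.ρ (update U ℓ g'))) := by
  haveI : SecondCountableTopology G := secondCountableTopology_of_latticeRep r
  set w : GaugeConfig 4 (2 * S + 1) G → ℝ := fun U => Real.exp (-β * wilsonAction r.ρ U) with hw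
  have hw_meas : Measurable w := ((measurable_wilsonAction r.ρ r.continuous).const_mul _).exp
  set c : GaugeConfig 4 (2 * S + 1) G → ℝ := fun U => ∫ g, w (update U ℓ g) ∂haarProbability G with hc
  have hwj : Measurable fun p : GaugeConfig 4 (2 * S + 1) G × G => w (update p.1 ℓ p.2) :=
    hw_meas.comp measurable_update'
  have hc_meas : Measurable c :=
    (hwj.stronglyMeasurable.integral_prod_right' (ν := haarProbability G)).measurable
  have hν : ∀ U : GaugeConfig 4 (2 * S + 1) G,
      (haarProbability G).tilted (fun g' => -β * wilsonAction r.ρ (update U ℓ g')) =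
        (haarProbability G).withDensity (fun g => ENNReal.ofReal (w (update U ℓ g) / c U)) :=
    fun U => rfl
  have hdν_meas : ∀ U, Measurable fun g : G => ENNReal.ofReal (w (update U ℓ g) / c U) := fun U =>
    ((hw_meas.comp (measurable_update U)).div_const _).ennreal_ofReal
  have hΦj : Measurable fun p : GaugeConfig 4 (2 * S + 1) G × G =>
      ENNReal.ofReal (w (update p.1 ℓ p.2) / c p.1) * K p :=
    ((hwj.div (hc_meas.comp measurable_fst)).ennreal_ofReal).mul hK
  have hinner : ∀ U : GaugeConfig 4 (2 * S + 1) G,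
      ∫⁻ g, K (U, g) ∂((haarProbability G).tilted (fun g' => -β * wilsonAction r.ρ (update U ℓ g'))) =
        ∫⁻ g, ENNReal.ofReal (w (update U ℓ g) / c U) * K (U, g) ∂haarProbability G := fun U => by
    have hm : Measurable fun g : G => K (U, g) := hK.comp measurable_prodMk_left
    rw [hν U, lintegral_withDensity_eq_lintegral_mul _ (hdν_meas U) hm]
    rfl
  simp_rw [hinner]
  exact hΦj.lintegral_prod_right'

/-- Measurability of `U ↦ ∫ ψ(U[ℓ ↦ g]) dν_ℓ^U(g)` for measurable `ψ ≥ 0`. [folklore] -/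
theorem measurable_lintegral_heatBath_update (r : LatticeRep G) (β : ℝ) (S : ℕ) (ℓ : Edge 4 (2 * S + 1))
    {ψ : GaugeConfig 4 (2 * S + 1) G → ℝ≥0∞} (hψ : Measurable ψ) :
    Measurable fun U : GaugeConfig 4 (2 * S + 1) G => ∫⁻ g, ψ (update U ℓ g)
      ∂((haarProbability G).tilted (fun g' => -β * wilsonAction r.ρ (update U ℓ g'))) :=
  measurable_lintegral_heatBath r β S ℓ (K := fun p => ψ (update p.1 ℓ p.2)) (hψ.comp measurable_update')

/-- The one-link heat-bath law is a probability measure. [folklore] -/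
theorem isProbabilityMeasure_heatBath (r : LatticeRep G) (β : ℝ) (S : ℕ) (ℓ : Edge 4 (2 * S + 1))
    (U : GaugeConfig 4 (2 * S + 1) G) :
    IsProbabilityMeasure ((haarProbability G).tilted (fun g' => -β * wilsonAction r.ρ (update U ℓ g'))) := by
  haveI : SecondCountableTopology G := secondCountableTopology_of_latticeRep r
  refine isProbabilityMeasure_tilted ?_
  obtain ⟨B, hB⟩ := exists_abs_wilsonAction_le (d := 4) (L := 2 * S + 1) r.ρ r.continuous
  have hmeas : Measurable fun g : G => Real.exp (-β * wilsonAction r.ρ (update U ℓ g)) :=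
    (((measurable_wilsonAction r.ρ r.continuous).comp (measurable_update U)).const_mul _).exp
  refine Integrable.of_bound hmeas.aestronglyMeasurable (Real.exp (|β| * B)) (ae_of_all _ fun g => ?_)
  rw [Real.norm_eq_abs, Real.abs_exp, Real.exp_le_exp]
  have h : |β * wilsonAction r.ρ (update U ℓ g)| ≤ |β| * B := by
    rw [abs_mul]; exact mul_le_mul_of_nonneg_left (hB _) (abs_nonneg _)
  have := (abs_le.1 h).1
  linarith

/-- **Heat-bath boundary flux of an event conserved away from a bad set.** If membership in `A` is unchanged by every
single-link modification `U ↦ U[ℓ ↦ g]` with both `U` and `U[ℓ ↦ g]` outside the "bad" event `B`, then the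
single-link heat-bath Dirichlet form of `1_A` on the torus of side `2S+1` is at most `2 · #E · μ_{β,S}(B)`:
pointwise `(1_A U − 1_A U')² ≤ 1_B U + 1_B U'`, and the heat-bath pair `(U, U')` is exchangeable
(`lintegral_heatBath_update`). This is the form in which a twist-sector obstruction enters: `A` = a sector,
`B` = configurations with a large monopole cluster. [folklore] -/
theorem hbForm_indicator_le_of_conserved (r : LatticeRep G) (β : ℝ) (S : ℕ)
    {A B : Set (GaugeConfig 4 (2 * S + 1) G)} (hA : MeasurableSet A) (hB : MeasurableSet B)
    (hcons : ∀ (ℓ : Edge 4 (2 * S + 1)) (U : GaugeConfig 4 (2 * S + 1) G) (g : G),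
      U ∉ B → update U ℓ g ∉ B → (U ∈ A ↔ update U ℓ g ∈ A)) :
    ∑ ℓ : Edge 4 (2 * S + 1), ∫ U, ∫ g,
        (A.indicator (1 : GaugeConfig 4 (2 * S + 1) G → ℝ) U - A.indicator 1 (update U ℓ g)) ^ 2
      ∂((haarProbability G).tilted (fun g' => -β * wilsonAction r.ρ (update U ℓ g')))
      ∂(wilsonMeasure (d := 4) (L := 2 * S + 1) r.ρ β) ≤
    2 * (Fintype.card (Edge 4 (2 * S + 1)) : ℝ) * (wilsonMeasure (d := 4) (L := 2 * S + 1) r.ρ β).real B := by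
  haveI := isProbabilityMeasure_wilsonMeasure (d := 4) (L := 2 * S + 1) (G := G) r.ρ r.continuous β
  set μ : Measure (GaugeConfig 4 (2 * S + 1) G) := wilsonMeasure (d := 4) (L := 2 * S + 1) r.ρ β with hμdef
  -- it suffices to bound each link term by `2 μ(B)`
  have hterm : ∀ ℓ : Edge 4 (2 * S + 1), ∫ U, ∫ g,
        (A.indicator (1 : GaugeConfig 4 (2 * S + 1) G → ℝ) U - A.indicator 1 (update U ℓ g)) ^ 2
      ∂((haarProbability G).tilted (fun g' => -β * wilsonAction r.ρ (update U ℓ g'))) ∂μ ≤ 2 * μ.real B := by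
    intro ℓ
    -- the integrand as an extended non-negative function
    set D : GaugeConfig 4 (2 * S + 1) G → G → ℝ≥0∞ := fun U g =>
      ENNReal.ofReal ((A.indicator (1 : GaugeConfig 4 (2 * S + 1) G → ℝ) U - A.indicator 1 (update U ℓ g)) ^ 2)
      with hD
    have hFmeas : Measurable (A.indicator (1 : GaugeConfig 4 (2 * S + 1) G → ℝ)) := measurable_one.indicator hA
    have hDj : Measurable fun p : GaugeConfig 4 (2 * S + 1) G × G => D p.1 p.2 :=
      (((hFmeas.comp measurable_fst).sub (hFmeas.comp measurable_update')).pow_const 2).ennreal_ofReal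
    have hDU : ∀ U, Measurable (D U) := fun U =>
      ((measurable_const.sub (hFmeas.comp (measurable_update U))).pow_const 2).ennreal_ofReal
    have hD_le_one : ∀ U g, D U g ≤ 1 := fun U g => by
      rw [hD]
      refine ENNReal.ofReal_le_one.2 ?_
      by_cases h1 : U ∈ A <;> by_cases h2 : update U ℓ g ∈ A <;> simp [Set.indicator, h1, h2]
    -- pointwise domination by the bad indicators
    have hdom : ∀ U g, D U g ≤ B.indicator (1 : GaugeConfig 4 (2 * S + 1) G → ℝ≥0∞) U +
        B.indicator (1 : GaugeConfig 4 (2 * S + 1) G → ℝ≥0∞) (update U ℓ g) := by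
      intro U g
      by_cases hU : U ∈ B
      · have h1 : B.indicator (1 : GaugeConfig 4 (2 * S + 1) G → ℝ≥0∞) U = 1 := by
          rw [Set.indicator_of_mem hU, Pi.one_apply]
        rw [h1]
        exact le_add_right (hD_le_one U g)
      by_cases hU' : update U ℓ g ∈ B
      · have h1 : B.indicator (1 : GaugeConfig 4 (2 * S + 1) G → ℝ≥0∞) (update U ℓ g) = 1 := by
          rw [Set.indicator_of_mem hU', Pi.one_apply]
        rw [h1]
        exact le_add_left (hD_le_one U g)
      · have hiff := hcons ℓ U g hU hU'
        have h0 : D U g = 0 := by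
          rw [hD]
          by_cases h1 : U ∈ A
          · simp [Set.indicator, h1, hiff.1 h1]
          · simp [Set.indicator, h1, mt hiff.2 h1]
        rw [h0]
        exact bot_le
    -- the heat-bath laws are probability measures
    have hprob : ∀ U : GaugeConfig 4 (2 * S + 1) G,
        IsProbabilityMeasure ((haarProbability G).tilted (fun g' => -β * wilsonAction r.ρ (update U ℓ g'))) :=
      fun U => isProbabilityMeasure_heatBath r β S ℓ U
    -- inner Bochner integral = toReal of the inner lintegral
    have hinner : ∀ U : GaugeConfig 4 (2 * S + 1) G,
        ∫ g, (A.indicator (1 : GaugeConfig 4 (2 * S + 1) G → ℝ) U - A.indicator 1 (update U ℓ g)) ^ 2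
          ∂((haarProbability G).tilted (fun g' => -β * wilsonAction r.ρ (update U ℓ g'))) =
        (∫⁻ g, D U g ∂((haarProbability G).tilted (fun g' => -β * wilsonAction r.ρ (update U ℓ g')))).toReal :=
      fun U => integral_eq_lintegral_of_nonneg_ae (ae_of_all _ fun g => sq_nonneg _)
        ((measurable_const.sub (hFmeas.comp (measurable_update U))).pow_const 2).aestronglyMeasurable
    -- the inner lintegral is at most 1, hence finite, and measurable in `U`
    have hI_le_one : ∀ U : GaugeConfig 4 (2 * S + 1) G,
        ∫⁻ g, D U g ∂((haarProbability G).tilted (fun g' => -β * wilsonAction r.ρ (update U ℓ g'))) ≤ 1 :=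
      fun U => by
        haveI := hprob U
        calc _ ≤ ∫⁻ _g, (1 : ℝ≥0∞) ∂((haarProbability G).tilted (fun g' => -β * wilsonAction r.ρ (update U ℓ g'))) :=
              lintegral_mono (hD_le_one U)
          _ = 1 := by rw [lintegral_const, measure_univ, mul_one]
    have hmeasI : Measurable fun U : GaugeConfig 4 (2 * S + 1) G =>
        ∫⁻ g, D U g ∂((haarProbability G).tilted (fun g' => -β * wilsonAction r.ρ (update U ℓ g'))) :=
      measurable_lintegral_heatBath r β S ℓ (K := fun p => D p.1 p.2) hDj
    -- outer Bochner integral = toReal of the double lintegral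
    have hout : ∫ U, (∫⁻ g, D U g ∂((haarProbability G).tilted (fun g' => -β * wilsonAction r.ρ (update U ℓ g')))).toReal ∂μ =
        (∫⁻ U, ∫⁻ g, D U g ∂((haarProbability G).tilted (fun g' => -β * wilsonAction r.ρ (update U ℓ g'))) ∂μ).toReal :=
      integral_toReal hmeasI.aemeasurable (ae_of_all _ fun U => (hI_le_one U).trans_lt ENNReal.one_lt_top)
    -- the double lintegral is at most `μ B + μ B` (domination + exchangeability)
    have hBmeas : Measurable (B.indicator (1 : GaugeConfig 4 (2 * S + 1) G → ℝ≥0∞)) := measurable_one.indicator hB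
    have hdouble : ∫⁻ U, ∫⁻ g, D U g ∂((haarProbability G).tilted (fun g' => -β * wilsonAction r.ρ (update U ℓ g'))) ∂μ ≤
        μ B + μ B := by
      calc _ ≤ ∫⁻ U, (B.indicator (1 : GaugeConfig 4 (2 * S + 1) G → ℝ≥0∞) U +
              ∫⁻ g, B.indicator (1 : GaugeConfig 4 (2 * S + 1) G → ℝ≥0∞) (update U ℓ g)
                ∂((haarProbability G).tilted (fun g' => -β * wilsonAction r.ρ (update U ℓ g')))) ∂μ := by
            refine lintegral_mono fun U => ?_
            haveI := hprob U
            calc _ ≤ ∫⁻ g, (B.indicator (1 : GaugeConfig 4 (2 * S + 1) G → ℝ≥0∞) U +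
                  B.indicator (1 : GaugeConfig 4 (2 * S + 1) G → ℝ≥0∞) (update U ℓ g))
                    ∂((haarProbability G).tilted (fun g' => -β * wilsonAction r.ρ (update U ℓ g'))) :=
                  lintegral_mono (hdom U)
              _ = _ := by
                  rw [lintegral_add_left measurable_const, lintegral_const, measure_univ, mul_one]
        _ = ∫⁻ U, B.indicator (1 : GaugeConfig 4 (2 * S + 1) G → ℝ≥0∞) U ∂μ +
            ∫⁻ U, ∫⁻ g, B.indicator (1 : GaugeConfig 4 (2 * S + 1) G → ℝ≥0∞) (update U ℓ g)
              ∂((haarProbability G).tilted (fun g' => -β * wilsonAction r.ρ (update U ℓ g'))) ∂μ :=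
            lintegral_add_left hBmeas _
        _ = μ B + μ B := by
            rw [lintegral_indicator_one hB, hμdef, lintegral_heatBath_update r β S ℓ hBmeas,
              lintegral_indicator_one hB]
    -- assemble
    have hfin : μ B + μ B ≠ ∞ := ENNReal.add_ne_top.2 ⟨measure_ne_top _ _, measure_ne_top _ _⟩
    calc ∫ U, ∫ g, (A.indicator (1 : GaugeConfig 4 (2 * S + 1) G → ℝ) U - A.indicator 1 (update U ℓ g)) ^ 2
          ∂((haarProbability G).tilted (fun g' => -β * wilsonAction r.ρ (update U ℓ g'))) ∂μ
        = (∫⁻ U, ∫⁻ g, D U g ∂((haarProbability G).tilted (fun g' => -β * wilsonAction r.ρ (update U ℓ g'))) ∂μ).toReal := by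
          rw [← hout]; exact integral_congr_ae (ae_of_all _ hinner)
      _ ≤ (μ B + μ B).toReal := ENNReal.toReal_mono hfin hdouble
      _ = 2 * μ.real B := by
          rw [ENNReal.toReal_add (measure_ne_top _ _) (measure_ne_top _ _), measureReal_def]; ring
  calc ∑ ℓ : Edge 4 (2 * S + 1), ∫ U, ∫ g,
          (A.indicator (1 : GaugeConfig 4 (2 * S + 1) G → ℝ) U - A.indicator 1 (update U ℓ g)) ^ 2
        ∂((haarProbability G).tilted (fun g' => -β * wilsonAction r.ρ (update U ℓ g'))) ∂μ
      ≤ ∑ _ℓ : Edge 4 (2 * S + 1), 2 * μ.real B := Finset.sum_le_sum fun ℓ _ => hterm ℓ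
    _ = 2 * (Fintype.card (Edge 4 (2 * S + 1)) : ℝ) * μ.real B := by
        rw [Finset.sum_const, Finset.card_univ, nsmul_eq_mul]; ring

/-- **UP forces purity of conserved events** (tree: `Negative.measureReal_mul_le_of_conserved`): with a heat-bath
Poincaré constant `C ≥ 0`, every event conserved by single-link moves outside a bad event `B` has
`μ(A)(1 − μ(A)) ≤ 2C · #E · μ(B)` — for SO(3), "UP ⟹ one 't Hooft twist sector carries all the mass". -/
theorem purity_of_conserved (r : LatticeRep G) (β C : ℝ) (hC : UPWith r β C) (hC0 : 0 ≤ C) (S : ℕ)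
    {A B : Set (GaugeConfig 4 (2 * S + 1) G)} (hA : MeasurableSet A) (hB : MeasurableSet B)
    (hcons : ∀ (ℓ : Edge 4 (2 * S + 1)) (U : GaugeConfig 4 (2 * S + 1) G) (g : G),
      U ∉ B → update U ℓ g ∉ B → (U ∈ A ↔ update U ℓ g ∈ A)) :
    (wilsonMeasure (d := 4) (L := 2 * S + 1) r.ρ β).real A *
        (1 - (wilsonMeasure (d := 4) (L := 2 * S + 1) r.ρ β).real A) ≤
      2 * C * (Fintype.card (Edge 4 (2 * S + 1)) : ℝ) * (wilsonMeasure (d := 4) (L := 2 * S + 1) r.ρ β).real B := by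
  refine (flux_lower_bound_of_UP r β C hC S hA).trans ?_
  have h := mul_le_mul_of_nonneg_left (hbForm_indicator_le_of_conserved r β S hA hB hcons) hC0
  calc C * hbForm r β S (A.indicator 1)
      ≤ C * (2 * (Fintype.card (Edge 4 (2 * S + 1)) : ℝ) * (wilsonMeasure (d := 4) (L := 2 * S + 1) r.ρ β).real B) := by
        simpa [hbForm] using h
    _ = _ := by ring

/-- **`H` from a conservation law** (tree: `Negative.twistSectorInputs_of_conserved`): the data of `H` with (iii)
replaced by (iii-a) conservation of `A S` under single-link moves outside bad events `B S` and (iii-b) `#E · μ(B S) → 0`. -/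
theorem twistSectorInputs_of_conserved (G : Type) [Group G] [TopologicalSpace G] [IsTopologicalGroup G]
    [CompactSpace G] [MeasurableSpace G] [BorelSpace G] (hsimple : IsCompactSimpleLieGroup G)
    (hnsc : ¬ SimplyConnectedSpace G) (r : LatticeRep G) (β : ℝ) (hβ : 0 ≤ β) (hfs : FS r β)
    (δ : ℝ) (hδ : 0 < δ) (A B : ∀ S : ℕ, Set (GaugeConfig 4 (2 * S + 1) G))
    (hA : ∀ S, MeasurableSet (A S)) (hB : ∀ S, MeasurableSet (B S))
    (hinv : ∀ S, IsGaugeInvariant ((A S).indicator (1 : GaugeConfig 4 (2 * S + 1) G → ℝ)))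
    (hmass : ∀ S, δ ≤ (wilsonMeasure (d := 4) (L := 2 * S + 1) r.ρ β).real (A S) ∧
      (wilsonMeasure (d := 4) (L := 2 * S + 1) r.ρ β).real (A S) ≤ 1 - δ)
    (hcons : ∀ (S : ℕ) (ℓ : Edge 4 (2 * S + 1)) (U : GaugeConfig 4 (2 * S + 1) G) (g : G),
      U ∉ B S → update U ℓ g ∉ B S → (U ∈ A S ↔ update U ℓ g ∈ A S))
    (hbad : Tendsto (fun S : ℕ => (Fintype.card (Edge 4 (2 * S + 1)) : ℝ) *
      (wilsonMeasure (d := 4) (L := 2 * S + 1) r.ρ β).real (B S)) atTop (𝓝 0)) :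
    TwistSectorInputs := by
  refine ⟨G, _, _, _, _, _, _, hsimple, hnsc, r, β, hβ, hfs, δ, hδ, A, hA, hinv, hmass, ?_⟩
  have h2 : Tendsto (fun S : ℕ => 2 * ((Fintype.card (Edge 4 (2 * S + 1)) : ℝ) *
      (wilsonMeasure (d := 4) (L := 2 * S + 1) r.ρ β).real (B S))) atTop (𝓝 (2 * 0)) := hbad.const_mul 2
  rw [mul_zero] at h2
  refine tendsto_of_tendsto_of_tendsto_of_le_of_le tendsto_const_nhds h2 (fun S => hbForm_nonneg r β S _)
    (fun S => ?_)
  simpa [hbForm, mul_assoc] using hbForm_indicator_le_of_conserved r β S (hA S) (hB S) (hcons S)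

end Glue

/-- **The repaired statement C′** (what the planner should file if `H` is ever inhabited; = the crux with the
extra hypothesis `SimplyConnectedSpace G`, i.e. stub 4a `stub_fsPoincareInv_simplyConnected` of line
orbit-slice-reduction composed with the proved transfer UP_inv ⇒ UP). The twist witness does not bite C′. -/
def SusceptibilityToPoincareSC : Prop :=
  ∀ (G : Type) [Group G] [TopologicalSpace G] [IsTopologicalGroup G] [CompactSpace G]
    [MeasurableSpace G] [BorelSpace G], IsCompactSimpleLieGroup G → SimplyConnectedSpace G →
    ∀ (r : LatticeRep G) (β : ℝ), 0 ≤ β → FS r β → UP r β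

/-- C′ is (trivially) weaker than the crux. -/
theorem susceptibilityToPoincareSC_of_crux
    (h : Summit.QuantumFields.YangMills.Theses.FradkinShenkerFlow.SusceptibilityToPoincare) :
    SusceptibilityToPoincareSC :=
  fun G _ _ _ _ _ _ hG _ r β hβ hFS => crux_iff.1 h G hG r β hβ hFS

end NegativeModulo

/-! ### §3 Target: the lead's scope sentinel `stub_fsPoincareInv_nonSimplyConnected` (line orbit-slice-reduction) -/

section Targets

/-- Verbatim restatement of `OrbitSliceReduction.stub_fsPoincareInv_nonSimplyConnected` (Lines/orbit-slice-reduction.lean,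
skeleton sha 521baf1b3135): FS ⇒ UP_inv (Poincaré for gauge-INVARIANT bounded measurable `F`) for compact simple `G`
that is NOT simply connected. -/
def Stub4b : Prop :=
  ∀ (G : Type) [Group G] [TopologicalSpace G] [IsTopologicalGroup G] [CompactSpace G]
    [MeasurableSpace G] [BorelSpace G], IsCompactSimpleLieGroup G → ¬ SimplyConnectedSpace G →
    ∀ (r : LatticeRep G) (β : ℝ), 0 ≤ β →
    (∀ A B : YMSpecies G, ∃ χ : ℝ, ∀ S : ℕ, ∑ x ∈ Literature.Probability.LatticeModels.box 4 S,
      |covariance (fun U => A.F (Literature.MathematicalPhysics.QuantumLattice.torusLift (2 * S + 1) U))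
        (fun U => B.F (Literature.MathematicalPhysics.QuantumLattice.configShift (-x)
        (Literature.MathematicalPhysics.QuantumLattice.torusLift (2 * S + 1) U)))
        (wilsonMeasure (d := 4) (L := 2 * S + 1) r.ρ β)| ≤ χ) →
    ∃ C : ℝ, ∀ S : ℕ, ∀ F : GaugeConfig 4 (2 * S + 1) G → ℝ, Measurable F → (∃ M : ℝ, ∀ U, |F U| ≤ M) →
      IsGaugeInvariant F →
      variance F (wilsonMeasure (d := 4) (L := 2 * S + 1) r.ρ β) ≤
        C * ∑ ℓ : Edge 4 (2 * S + 1), ∫ U, ∫ g, (F U - F (Function.update U ℓ g)) ^ 2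
          ∂((haarProbability G).tilted (fun g' => -β * wilsonAction r.ρ (Function.update U ℓ g')))
          ∂(wilsonMeasure (d := 4) (L := 2 * S + 1) r.ρ β)

/-- **stub-false modulo `H`** (tree: `Negative.stub_fsPoincareInv_nonSimplyConnected_false_of_TwistSectorInputs`): the
same twist-sector inputs kill the lead's stub 4b (the witness events are gauge-invariant, so the invariant-sector
Poincaré inequality already fails). -/
theorem stub4b_false_of_twistSectorInputs (h : TwistSectorInputs) : ¬ Stub4b := by
  intro hstub
  obtain ⟨G, _, _, _, _, _, _, hsimple, hnsc, r, β, hβ, hfs, δ, hδ, A, hmeas, hinv, hmass, hflux⟩ := h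
  obtain ⟨C, hC⟩ := hstub G hsimple hnsc r β hβ hfs
  have hδ1 : δ ≤ 1 - δ := (hmass 0).1.trans (hmass 0).2
  have hpos : 0 < δ * (1 - δ) := mul_pos hδ (by linarith)
  have hle : ∀ S, δ * (1 - δ) ≤ C * hbForm r β S ((A S).indicator 1) := fun S => by
    refine (mul_one_sub_ge (hmass S).1 (hmass S).2).trans ?_
    rw [← variance_indicator_wilson r β S (hmeas S)]
    exact hC S _ (measurable_one.indicator (hmeas S)) ⟨1, fun U => by
      by_cases hU : U ∈ A S <;> simp [Set.indicator, hU]⟩ (hinv S)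
  have hlim : Tendsto (fun S => C * hbForm r β S ((A S).indicator 1)) atTop (𝓝 (C * 0)) := hflux.const_mul C
  rw [mul_zero] at hlim
  have : δ * (1 - δ) ≤ 0 := ge_of_tendsto hlim (Eventually.of_forall hle)
  linarith

end Targets

/-! ### §4 Load-bearing analysis (paper; no Lean-decidable content)

* `IsCompactSimpleLieGroup G`: WITHOUT connectedness the statement is false on paper already for `G = ℤ₂` (sign rep,
  `β` large): FS holds (self-duality + convergent expansion on the strong-coupling side), while the Polyakov centre
  sectors `sign Σ_{x⊥} P_μ(x⊥)` are exactly degenerate (centre symmetry) and separated by Peierls interfaces of area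
  `L²` ⟹ `ℰ_hb → 0`, Var `= 1`: bottleneck. WITHOUT simple-connectedness (allowed as typed!) see §2. The `Nonempty
  (LatticeRep G)` conjunct is decoration (`crux_iff_simpleOnly`).
* `0 ≤ β`: no mechanism found that uses the sign of `β`; possibly unnecessary (information for the prover).
* FS hypothesis: load-bearing on paper — at a bulk first-order point (SU(N ≥ 4) Wilson axis; mixed representations)
  UP fails (phase-coexistence tunnelling `e^{−cL³}`) and so does FS (torus covariance of the plaquette does not decay),
  so "UP for all `β ≥ 0`" is false while the crux survives there vacuously.
* `Measurable F`, `∃ M, |F| ≤ M`: technical (variance and Bochner integrals are junk-valued otherwise); no informative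
  mutation.
* `∃ C ∀ S` vs `∀ S ∃ C`: the per-`S` inequality is TRUE for every compact `G`, real `β` (density `e^{∓2|β| osc S_W}`
  w.r.t. product Haar ⟹ Holley–Stroock + Efron–Stein, tree `EfronSteinInequality`); a prover's lemma, recorded here
  because it pins the ENTIRE content of the crux on uniformity in `S`.
* MUTATION OF THE HYPOTHESIS (strengthen FS): replacing FS by ANY statement about bounded gauge-invariant LOCAL observables —
  exponential clustering uniformly in the volume, analyticity, complete analyticity of local expectations — does not rescue UP for
  centreless `G`: the twist witness is invisible to contractible-loop observables up to `e^{−mS}` and the bottleneck uses only the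
  sector indicator. The defect is the SCOPE OF THE CONCLUSION (all bounded measurable `F`, sector labels included), not the weakness
  of FS; hence the sector-conditioned UP of §5 (c) or the `SimplyConnectedSpace` re-scoping, not a stronger hypothesis.
* Strengthenings refuted on paper: "C independent of β" (hemisphere indicator of one link: Var = 1/4 vs
  `ℰ_hb ≍ β^{-1/2}`, refuter g40-11); "UP ⇒ FS-free" (first-order points, above).
-/

/-! ### §5 Consequences for the route (for the tenure planner; not a card)

* REPAIR C′ (`SusceptibilityToPoincareSC`, = stub 4a + the proved transfer UP_inv ⇒ UP) is the minimal restatement the twist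
  witness misses. BUT the route's `closes` feeds `SusceptibilityToPoincare` for EVERY admissible `G` into
  `PoincareToClustering` and `ClusteringToYangMills` (both `∀ G, IsCompactSimpleLieGroup G → …`); with C′ the assembly no
  longer type-checks for centreless `G` (SO(3), PSU(N), SO(2n+1), PSp(n), E₆/ℤ₃, E₇/ℤ₂ …). Either (a) add a COVERING TRANSFER
  item (EC for the `G̃/Z`-theory from the `G̃`-theory — a universality statement between two different lattice regularisations,
  itself open), or (b) re-scope cruxes 3–4 and accept that the line reaches only the simply-connected part of the summit, or
  (c) replace UP by a SECTOR-CONDITIONED Poincaré inequality (`μ_{β,S}(· | w = m)`, uniformly in `S` and `m`), which is what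
  exponential clustering of LOCAL observables actually needs and which the twist obstruction does not touch — at the price of
  formalising the twist class `w` (the same finite combinatorics as conjunct (iii-a) of `H`).
* Every admissible non-simply-connected `G` is bitten, not only SO(3): a twist in one plane has zero-action flat representatives
  as soon as the commutator map of the simply-connected cover hits the relevant central element (c-pairs exist for every
  central `c`; Borel–Friedman–Morgan), so the sector structure and the conservation law are identical.
* For the provers of stubs (2a)–(3): nothing here constrains them (they hold for every compact `G` and real `β`); the landed
  `Negative/HeatBathExchange.lean` (`lintegral_heatBath_update`, `measurable_lintegral_heatBath`, `isProbabilityMeasure_heatBath`)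
  is importable and gives the heat-bath DLR identity `E_μ E_{ν_ℓ^U}[ψ(U[ℓ ↦ g])] = E_μ ψ` and the measurability of heat-bath
  expectations that (2c)/(3) need.
-/

end

end Summit.QuantumFields.YangMills.Cruxes.SusceptibilityToPoincare.Disproof
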